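/-
Copyright (c) 2026 the pub-hodgecm-mathlib formalisation cell (harness21).  Prover seat hodgecm-mathlib-LH4-p14 (g3): Track A «(D-RAM) FOUR-FRAME» squad of crux H413, (ρ2b′-X) payer of record;
organ T2 «GLUE FIBRE» of the payer ORDER v1 (`F0/P3c/LH4/LH4-p14/g3/RHO2BX-ORDER.v1.LH4p14g3.md`), 2026-09-04.
-/
import Literature.NumberTheory.Automorphic.UnitaryLatticeTreeTubeAxisVertex        -- ★ (F0P2-p01 (g16)): `endoShapeForm_hermitian`; brings ★ TubeCoordinate (`exists_tubeCoordinate`, `exists_smul_add_of_tubeCoordinate`), ★ BlockGluing, (SD-W)∕(SD-e), ★ Framed (`exists_eq_latt_of_latt_le_of_le_latt`)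
import HarnessLib

/-!
# The lattice graph of a hermitian space — THE GLUE FIBRE: self-dual lattices with a given W-part and tube coordinate are parametrised by ONE unit class
# (Jacobowitz 1962 §4; Bruhat–Tits 1972 §10; Kottwitz 1986 §1)

Topic `NumberTheory/Automorphic`; namespace `Literature.NumberTheory.Automorphic.UnitaryLatticeTree`.  THEOREMS ONLY (no definition, no instance, no notation, no named fact,
no `sorry`); kernel lane `--supports stmt-HodgeConjecture-24833 --as helper`; DATUM-FREE (`K` with `Valued K ℤᵐ⁰`, `σ` a valuation-preserving involution, `|ϖ| = exp(−1)`; no `|2| = 1`,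
no `σϖ = ±ϖ`).  Cell `pub/hodgecm-mathlib`, crux H413 = `stmt-HodgeConjecture-24833`; squad F0∕P3c∕LH4 «(D-RAM) FOUR-FRAME», the WILD type-(2) G-side census (ρ2b′-X) of
`Cruxes/H413/Lines/F0_P3c_DyRamFourFrame_U2H_HSide.lean` :418 (payer plan LH4-p12 (g3) v2 8ff3a79c D5 «glue decomposition»; payer ORDER v1 b16823cc organ T2).
HONEST LABEL: HC_CM is proved only modulo the 7 printed citations (2 remaining named inputs: hLiu418 = stmt-HodgeConjecture-24832, h413 = stmt-HodgeConjecture-24833) until rung 0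
closes; elementary lattice algebra over a valuation ring, no books consequence.

THE MATHEMATICS (BLOCK CURRENCY of ★ `UnitaryLatticeTreeTubeCoordinate`: `V = K³ = W ⊕ Ke₁`, `W = {x | x₁ = 0}`, form `H = !![H₂ 0 0, 0, H₂ 0 1; 0, h, 0; H₂ 1 0, 0, H₂ 1 1]`,
`det H₂` a unit, `|h| = 1`, `pr_W x = x − x₁e₁`).  A self-dual lattice `M` off the axis has a TUBE COORDINATE `b ≥ 1` (`c·e₁ ∈ M ⟺ |c| ≤ |ϖ|^b`) and a GENERATOR `x₀ ∈ M`
(`|x₀,₁| = |ϖ|^{−b}`).  This file isolates what the (ρ2b′-X) census needs of ★ `BlockGluing` + ★ `TubeCoordinate`: the FIBRE of `M ↦ (M ∩ W, b)`.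
* §1 `glueData_of_generator` — CONVERSE GLUING: `B := M ∩ W` and `x₀` satisfy (G1) «`B` is the `W`-dual of `B + 𝒪·pr_W x₀`» and (G2) `|⟨x₀, x₀⟩| ≤ 1`, and `M = B ⊔ 𝒪x₀`.
* §2 `eq_iff_of_generators` — INJECTIVITY: two such `M`, `M′` with the same `W`-part and generators differing by `d·e₁` coincide iff `|d| ≤ |ϖ|^b`; equivalently iff the
  UNIT CLASSES `ϖ^b·x₀,₁ ≡ ϖ^b·x₀′,₁ (mod ϖ^{2b})` agree.
* §3 `glued_of_glueData` — EXISTENCE: for a `W`-lattice `B` (sandwiched between two frames), `x₀ = w₀ + c₀e₁` with (G1), (G2) and `|c₀| = |ϖ|^{−b}`, the glued `B ⊔ 𝒪x₀` is a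
  self-dual lattice with `W`-part `B`, tube coordinate `b` and generator `x₀`.
So `Fibre(B, b) ≅ {u ∈ 𝒪^× mod ϖ^{2b} : |⟨w₀, w₀⟩ + σ(u)·u·h·σ(ϖ^{−b})ϖ^{−b}| ≤ 1}` for any generator direction `w₀` — the norm-residue set `Sol_{2b}` of ★ p856820
`WildQuadraticDatumNormFibres` (values `q^b ∕ 2q^b ∕ 0`, ★ p856847∕p856861): payer plan D5∕D6 `#glue = A(b, ξ)`.  (Count packaging and the `Γ`-fixed refinement — ★ tube
criterion `forall_mulVec_mem_iff_sub_smul_mulVec_proj_mem_of_generator` — are the sequel.)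

## References
* [Jacobowitz1962] R. Jacobowitz, *Hermitian forms over local fields*, Amer. J. Math. 84 (1962), §4 (dual lattices, gluing of modular components).
* [BruhatTits1972] F. Bruhat, J. Tits, *Groupes réductifs sur un corps local I*, Publ. Math. IHÉS 41 (1972), §10 (lattice models of the rank-one building).
* [Kottwitz1986BaseChangeUnits] R. E. Kottwitz, *Base change for unit elements of Hecke algebras*, Compositio Math. 60 (1986), §1 pp. 240–241 (orbital integrals of units as lattice counts).
-/

set_option autoImplicit false

noncomputable section

open scoped Valued WithZero Matrix MatrixGroups

namespace Literature.NumberTheory.Automorphic.UnitaryLatticeTree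

open Literature.NumberTheory.Automorphic Literature.NumberTheory.Automorphic.HermitianLattice

variable {K : Type*} [Field K] [Valued K ℤᵐ⁰]

/-! ## §0 Bookkeeping in the block currency -/

omit [Valued K ℤᵐ⁰] in
/-- `pr_W (c•x₀ + w) = c•pr_W x₀ + w` for `w ∈ W` (coordinatewise). [cite: BruhatTits1972, §10] -/
theorem proj_smul_add_of_apply_one_eq_zero (c : K) (x₀ w : Fin 3 → K) (hw : w 1 = 0) :
    (c • x₀ + w) - Pi.single 1 ((c • x₀ + w) 1) = c • (x₀ - Pi.single 1 (x₀ 1)) + w := by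
  ext j
  by_cases hj : j = 1
  · subst hj; simp [hw]
  · simp [Pi.single_eq_of_ne hj]

/-! ## §1 Converse gluing: the W-part and a generator of a self-dual lattice satisfy (G1)(G2) -/

/-- **CONVERSE GLUING.**  For a SELF-DUAL `M` (block form) with tube coordinate `b ≥ 1` and a generator `x₀ ∈ M` (`|x₀,₁|·|ϖ|^b = 1`): with `B := M ∩ W`,
(G1) for `w ∈ W`: `w ∈ B ⟺ (∀ y ∈ B, |⟨y, w⟩| ≤ 1) ∧ |⟨x₀, w⟩| ≤ 1` (★ (SD-W) + generation `M = 𝒪x₀ + B`), (G2) `|⟨x₀, x₀⟩| ≤ 1` (`M ≤ M^♯`), and `M = B ⊔ 𝒪x₀`.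
[cite: Jacobowitz1962, §4] [cite: BruhatTits1972, §10] [cite: Kottwitz1986BaseChangeUnits, §1 pp. 240–241] -/
theorem glueData_of_generator (σ : K →+* K) (hvσ : ∀ a, Valued.v (σ a) = Valued.v a) {ϖ : K} (hϖ : Valued.v ϖ = WithZero.exp (-1 : ℤ))
    {H₂ : Matrix (Fin 2) (Fin 2) K} (hH₂ : IsUnit H₂.det) {h : K} (hh : Valued.v h = 1)
    {M : Submodule 𝒪[K] (Fin 3 → K)} (hM : IsSelfDualLattice σ ϖ (!![H₂ 0 0, 0, H₂ 0 1; 0, h, 0; H₂ 1 0, 0, H₂ 1 1] : Matrix (Fin 3) (Fin 3) K) M) {b : ℕ} (hb1 : 1 ≤ b)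
    (hb : ∀ c : K, (Pi.single 1 c : Fin 3 → K) ∈ M ↔ Valued.v c ≤ Valued.v ϖ ^ b) (hpr : ∀ x ∈ M, Valued.v (x 1) * Valued.v ϖ ^ b ≤ 1)
    {x₀ : Fin 3 → K} (hx₀ : x₀ ∈ M) (hx₀1 : Valued.v (x₀ 1) * Valued.v ϖ ^ b = 1) :
    (∀ w : Fin 3 → K, w 1 = 0 →
        (w ∈ M ⊓ LinearMap.ker ((LinearMap.proj (1 : Fin 3) : (Fin 3 → K) →ₗ[K] K).restrictScalars 𝒪[K]) ↔
          (∀ y ∈ M ⊓ LinearMap.ker ((LinearMap.proj (1 : Fin 3) : (Fin 3 → K) →ₗ[K] K).restrictScalars 𝒪[K]),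
              Valued.v (pairing σ (!![H₂ 0 0, 0, H₂ 0 1; 0, h, 0; H₂ 1 0, 0, H₂ 1 1] : Matrix (Fin 3) (Fin 3) K) y w) ≤ 1) ∧
            Valued.v (pairing σ (!![H₂ 0 0, 0, H₂ 0 1; 0, h, 0; H₂ 1 0, 0, H₂ 1 1] : Matrix (Fin 3) (Fin 3) K) x₀ w) ≤ 1)) ∧
      Valued.v (pairing σ (!![H₂ 0 0, 0, H₂ 0 1; 0, h, 0; H₂ 1 0, 0, H₂ 1 1] : Matrix (Fin 3) (Fin 3) K) x₀ x₀) ≤ 1 ∧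
      M = M ⊓ LinearMap.ker ((LinearMap.proj (1 : Fin 3) : (Fin 3 → K) →ₗ[K] K).restrictScalars 𝒪[K]) ⊔ Submodule.span 𝒪[K] {x₀} := by
  set H : Matrix (Fin 3) (Fin 3) K := !![H₂ 0 0, 0, H₂ 0 1; 0, h, 0; H₂ 1 0, 0, H₂ 1 1] with hHdef
  set Wk : Submodule 𝒪[K] (Fin 3 → K) := LinearMap.ker ((LinearMap.proj (1 : Fin 3) : (Fin 3 → K) →ₗ[K] K).restrictScalars 𝒪[K]) with hWk
  have hHrow : ∀ l : Fin 3, l ≠ 1 → H 1 l = 0 := fun l hl => endoShapeForm_row H₂ h l hl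
  have hHdet : IsUnit H.det := isUnit_det_endoShapeForm hH₂ hh
  have hMd : M ≤ dualLatt σ H M := le_dualLatt_of_isVertexLattice hvσ hM
  have hmemWk : ∀ w : Fin 3 → K, w ∈ Wk ↔ w 1 = 0 := fun w => by rw [hWk, LinearMap.mem_ker]; rfl
  -- generation `M = 𝒪x₀ + (M ∩ W)`
  obtain ⟨hgen, -⟩ := exists_smul_add_of_tubeCoordinate σ hvσ hϖ hh hM hb1 hb hpr hx₀ hx₀1
  refine ⟨fun w hw => ?_, (mem_dualLatt σ H M x₀).1 (hMd hx₀) x₀ hx₀, ?_⟩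
  · -- (G1)
    have hSDW := mem_iff_forall_pairing_proj_le_one_of_block hvσ (ϖ := ϖ) (H := H) 1 hHrow hHdet hM hw
    constructor
    · rintro ⟨hwM, -⟩
      refine ⟨fun y hy => ?_, ?_⟩
      · exact (mem_dualLatt σ H M w).1 (hMd hwM) y hy.1
      · have h1 := (hSDW.1 hwM) x₀ hx₀
        rwa [pairing_sub_single_left_of_block σ H 1 hHrow x₀ hw] at h1
    · rintro ⟨hB, hx⟩
      refine ⟨hSDW.2 fun m hm => ?_, (hmemWk w).2 hw⟩
      obtain ⟨c, y, hc, hyM, hy1, rfl⟩ := hgen m hm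
      rw [proj_smul_add_of_apply_one_eq_zero c x₀ y hy1, map_add, LinearMap.add_apply, LinearMap.map_smulₛₗ, LinearMap.smul_apply, smul_eq_mul,
        pairing_sub_single_left_of_block σ H 1 hHrow x₀ hw]
      refine (Valuation.map_add _ _ _).trans (max_le ?_ (hB y ⟨hyM, (hmemWk y).2 hy1⟩))
      rw [map_mul, hvσ]
      exact mul_le_one' hc hx
  · -- `M = (M ∩ W) ⊔ 𝒪x₀`
    refine le_antisymm (fun m hm => ?_) (sup_le inf_le_left ((Submodule.span_singleton_le_iff_mem _ _).2 hx₀))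
    obtain ⟨c, y, hc, hyM, hy1, rfl⟩ := hgen m hm
    rw [add_comm]
    exact mem_sup_span_singleton_iff.2 ⟨c, hc, by rw [add_sub_cancel_right]; exact ⟨hyM, (hmemWk y).2 hy1⟩⟩


/-! ## §2 Injectivity: same W-part, generators congruent modulo `ϖ^b·e₁` ⟺ same lattice -/

/-- **INJECTIVITY OF THE GLUE PARAMETER.**  Two SELF-DUAL lattices `M`, `M′` (block form, `σ` an isometric involution, `H` hermitian) with the same tube coordinate `b ≥ 1`,
the same `W`-part `M ∩ W = M′ ∩ W` and generators `x₀ ∈ M`, `x₀′ ∈ M′` with the same `W`-component (`pr_W x₀′ = pr_W x₀`) COINCIDE iff `|x₀′,₁ − x₀,₁| ≤ |ϖ|^b`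
(⇒: `(x₀′,₁ − x₀,₁)·e₁ ∈ M`; ⇐: ★ gluing classes `sup_span_eq_sup_span_of_glue` over §1).  In unit currency (`x₀,₁ = ϖ^{−b}u`): iff `u′ ≡ u (mod ϖ^{2b})`.
[cite: Jacobowitz1962, §4] [cite: BruhatTits1972, §10] -/
theorem eq_iff_of_generators (σ : K →+* K) (hσ : ∀ a, σ (σ a) = a) (hvσ : ∀ a, Valued.v (σ a) = Valued.v a) {ϖ : K} (hϖ : Valued.v ϖ = WithZero.exp (-1 : ℤ))
    {H₂ : Matrix (Fin 2) (Fin 2) K} (hH₂ : IsUnit H₂.det) (hH₂σ : (H₂.map σ)ᵀ = H₂) {h : K} (hh : Valued.v h = 1) (hhσ : σ h = h)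
    {M M' : Submodule 𝒪[K] (Fin 3 → K)} (hM : IsSelfDualLattice σ ϖ (!![H₂ 0 0, 0, H₂ 0 1; 0, h, 0; H₂ 1 0, 0, H₂ 1 1] : Matrix (Fin 3) (Fin 3) K) M)
    (hM' : IsSelfDualLattice σ ϖ (!![H₂ 0 0, 0, H₂ 0 1; 0, h, 0; H₂ 1 0, 0, H₂ 1 1] : Matrix (Fin 3) (Fin 3) K) M') {b : ℕ} (hb1 : 1 ≤ b)
    (hb : ∀ c : K, (Pi.single 1 c : Fin 3 → K) ∈ M ↔ Valued.v c ≤ Valued.v ϖ ^ b) (hpr : ∀ x ∈ M, Valued.v (x 1) * Valued.v ϖ ^ b ≤ 1)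
    (hb' : ∀ c : K, (Pi.single 1 c : Fin 3 → K) ∈ M' ↔ Valued.v c ≤ Valued.v ϖ ^ b) (hpr' : ∀ x ∈ M', Valued.v (x 1) * Valued.v ϖ ^ b ≤ 1)
    (hW : M ⊓ LinearMap.ker ((LinearMap.proj (1 : Fin 3) : (Fin 3 → K) →ₗ[K] K).restrictScalars 𝒪[K]) =
      M' ⊓ LinearMap.ker ((LinearMap.proj (1 : Fin 3) : (Fin 3 → K) →ₗ[K] K).restrictScalars 𝒪[K]))
    {x₀ x₀' : Fin 3 → K} (hx₀ : x₀ ∈ M) (hx₀1 : Valued.v (x₀ 1) * Valued.v ϖ ^ b = 1) (hx₀' : x₀' ∈ M') (hx₀'1 : Valued.v (x₀' 1) * Valued.v ϖ ^ b = 1)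
    (hdir : x₀' - Pi.single 1 (x₀' 1) = x₀ - Pi.single 1 (x₀ 1)) :
    M = M' ↔ Valued.v (x₀' 1 - x₀ 1) ≤ Valued.v ϖ ^ b := by
  set H : Matrix (Fin 3) (Fin 3) K := !![H₂ 0 0, 0, H₂ 0 1; 0, h, 0; H₂ 1 0, 0, H₂ 1 1] with hHdef
  set Wk : Submodule 𝒪[K] (Fin 3 → K) := LinearMap.ker ((LinearMap.proj (1 : Fin 3) : (Fin 3 → K) →ₗ[K] K).restrictScalars 𝒪[K]) with hWk
  have hHrow : ∀ l : Fin 3, l ≠ 1 → H 1 l = 0 := fun l hl => endoShapeForm_row H₂ h l hl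
  have hHcol : ∀ l : Fin 3, l ≠ 1 → H l 1 = 0 := fun l hl => endoShapeForm_col H₂ h l hl
  have hH11 : Valued.v (H 1 1) = 1 := by rw [show H 1 1 = h from endoShapeForm_one_one H₂ h]; exact hh
  have hsymm : ∀ x y : Fin 3 → K, Valued.v (pairing σ H y x) = Valued.v (pairing σ H x y) :=
    v_pairing_comm_of_hermitian hvσ hσ (endoShapeForm_hermitian hH₂σ hhσ)
  have hmemWk : ∀ w : Fin 3 → K, w ∈ Wk ↔ w 1 = 0 := fun w => by rw [hWk, LinearMap.mem_ker]; rfl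
  have hϖ0 : Valued.v ϖ ≠ 0 := by rw [hϖ]; exact WithZero.exp_ne_zero
  have hϖb0 : Valued.v ϖ ^ b ≠ 0 := pow_ne_zero _ hϖ0
  -- the two generators differ by `d·e₁`
  have hxd : x₀' = x₀ + Pi.single 1 (x₀' 1 - x₀ 1) := by
    have e : x₀' = (x₀' - Pi.single 1 (x₀' 1)) + Pi.single 1 (x₀' 1) := (sub_add_cancel _ _).symm
    rw [hdir] at e
    rw [Pi.single_sub]
    calc x₀' = (x₀ - Pi.single 1 (x₀ 1)) + Pi.single 1 (x₀' 1) := e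
      _ = x₀ + (Pi.single 1 (x₀' 1) - Pi.single 1 (x₀ 1)) := by abel
  constructor
  · intro hMM'
    have hmem : (Pi.single 1 (x₀' 1 - x₀ 1) : Fin 3 → K) ∈ M := by
      have h1 : x₀' - x₀ ∈ M := M.sub_mem (hMM' ▸ hx₀') hx₀
      rwa [hxd, add_sub_cancel_left] at h1
    exact (hb _).1 hmem
  · intro hd
    obtain ⟨hG1, hG2, hMeq⟩ := glueData_of_generator σ hvσ hϖ hH₂ hh hM hb1 hb hpr hx₀ hx₀1
    obtain ⟨-, -, hM'eq⟩ := glueData_of_generator σ hvσ hϖ hH₂ hh hM' hb1 hb' hpr' hx₀' hx₀'1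
    rw [hMeq, hM'eq, ← hW, hxd]
    -- `|x₀,₁| > 1` and `|d|·|x₀,₁| ≤ 1`
    have hx₀v : Valued.v (x₀ 1) = (Valued.v ϖ ^ b)⁻¹ := eq_inv_of_mul_eq_one_left hx₀1
    have hlt : 1 < Valued.v (x₀ 1) := by
      rw [hx₀v, one_lt_inv₀ (zero_lt_iff.2 hϖb0)]
      have hϖ1 : Valued.v ϖ < 1 := by rw [hϖ, ← WithZero.exp_zero, WithZero.exp_lt_exp]; omega
      exact pow_lt_one₀ zero_le hϖ1 (by omega)
    have hdd : Valued.v (x₀' 1 - x₀ 1) * Valued.v (x₀ 1) ≤ 1 := by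
      rw [hx₀v, mul_inv_le_iff₀ (zero_lt_iff.2 hϖb0), one_mul]
      exact hd
    exact (sup_span_eq_sup_span_of_glue (B := M ⊓ Wk) (i := 1) hvσ hsymm hHrow hHcol hH11 (fun y hy => (hmemWk y).1 hy.2) hlt hG1 hG2 hdd).symm

/-! ## §3 Existence: glueing a W-lattice and a generator with (G1)(G2) gives a member of the fibre -/

/-- **EXISTENCE (the glued lattice).**  For a `W`-submodule `B` and `x₀` with `|x₀,₁| = |ϖ|^{−b}`, `b ≥ 1`, satisfying (G1) «`B` is the `W`-dual of `B + 𝒪·pr_W x₀`» and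
(G2) `|⟨x₀, x₀⟩| ≤ 1`: the glued `M := B ⊔ 𝒪x₀` equals its own dual (★ gluing theorem), has tube coordinate `b` (`c·e₁ ∈ M ⟺ |c| ≤ |ϖ|^b`, ★ gluing §4), `W`-part exactly `B`,
and contains the generator `x₀`. [cite: Jacobowitz1962, §4] [cite: BruhatTits1972, §10] [cite: Kottwitz1986BaseChangeUnits, §1 pp. 240–241] -/
theorem glued_of_glueData (σ : K →+* K) (hσ : ∀ a, σ (σ a) = a) (hvσ : ∀ a, Valued.v (σ a) = Valued.v a) {ϖ : K} (hϖ : Valued.v ϖ = WithZero.exp (-1 : ℤ))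
    {H₂ : Matrix (Fin 2) (Fin 2) K} (hH₂σ : (H₂.map σ)ᵀ = H₂) {h : K} (hh : Valued.v h = 1) (hhσ : σ h = h)
    {B : Submodule 𝒪[K] (Fin 3 → K)} (hBW : ∀ y ∈ B, y 1 = 0) {b : ℕ} (hb1 : 1 ≤ b)
    {x₀ : Fin 3 → K} (hx₀1 : Valued.v (x₀ 1) * Valued.v ϖ ^ b = 1)
    (hG1 : ∀ w : Fin 3 → K, w 1 = 0 →
      (w ∈ B ↔ (∀ y ∈ B, Valued.v (pairing σ (!![H₂ 0 0, 0, H₂ 0 1; 0, h, 0; H₂ 1 0, 0, H₂ 1 1] : Matrix (Fin 3) (Fin 3) K) y w) ≤ 1) ∧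
        Valued.v (pairing σ (!![H₂ 0 0, 0, H₂ 0 1; 0, h, 0; H₂ 1 0, 0, H₂ 1 1] : Matrix (Fin 3) (Fin 3) K) x₀ w) ≤ 1))
    (hG2 : Valued.v (pairing σ (!![H₂ 0 0, 0, H₂ 0 1; 0, h, 0; H₂ 1 0, 0, H₂ 1 1] : Matrix (Fin 3) (Fin 3) K) x₀ x₀) ≤ 1) :
    dualLatt σ (!![H₂ 0 0, 0, H₂ 0 1; 0, h, 0; H₂ 1 0, 0, H₂ 1 1] : Matrix (Fin 3) (Fin 3) K) (B ⊔ Submodule.span 𝒪[K] {x₀}) = B ⊔ Submodule.span 𝒪[K] {x₀} ∧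
      (∀ c : K, (Pi.single 1 c : Fin 3 → K) ∈ B ⊔ Submodule.span 𝒪[K] {x₀} ↔ Valued.v c ≤ Valued.v ϖ ^ b) ∧
      (B ⊔ Submodule.span 𝒪[K] {x₀}) ⊓ LinearMap.ker ((LinearMap.proj (1 : Fin 3) : (Fin 3 → K) →ₗ[K] K).restrictScalars 𝒪[K]) = B ∧
      x₀ ∈ B ⊔ Submodule.span 𝒪[K] {x₀} := by
  set H : Matrix (Fin 3) (Fin 3) K := !![H₂ 0 0, 0, H₂ 0 1; 0, h, 0; H₂ 1 0, 0, H₂ 1 1] with hHdef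
  set Wk : Submodule 𝒪[K] (Fin 3 → K) := LinearMap.ker ((LinearMap.proj (1 : Fin 3) : (Fin 3 → K) →ₗ[K] K).restrictScalars 𝒪[K]) with hWk
  have hHrow : ∀ l : Fin 3, l ≠ 1 → H 1 l = 0 := fun l hl => endoShapeForm_row H₂ h l hl
  have hHcol : ∀ l : Fin 3, l ≠ 1 → H l 1 = 0 := fun l hl => endoShapeForm_col H₂ h l hl
  have hH11 : Valued.v (H 1 1) = 1 := by rw [show H 1 1 = h from endoShapeForm_one_one H₂ h]; exact hh
  have hsymm : ∀ x y : Fin 3 → K, Valued.v (pairing σ H y x) = Valued.v (pairing σ H x y) :=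
    v_pairing_comm_of_hermitian hvσ hσ (endoShapeForm_hermitian hH₂σ hhσ)
  have hmemWk : ∀ w : Fin 3 → K, w ∈ Wk ↔ w 1 = 0 := fun w => by rw [hWk, LinearMap.mem_ker]; rfl
  have hϖ0 : Valued.v ϖ ≠ 0 := by rw [hϖ]; exact WithZero.exp_ne_zero
  have hϖb0 : Valued.v ϖ ^ b ≠ 0 := pow_ne_zero _ hϖ0
  have hx₀v : Valued.v (x₀ 1) = (Valued.v ϖ ^ b)⁻¹ := eq_inv_of_mul_eq_one_left hx₀1
  have hx₀10 : x₀ 1 ≠ 0 := fun h0 => by rw [h0, map_zero, zero_mul] at hx₀1; exact zero_ne_one hx₀1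
  have hlt : 1 < Valued.v (x₀ 1) := by
    rw [hx₀v, one_lt_inv₀ (zero_lt_iff.2 hϖb0)]
    have hϖ1 : Valued.v ϖ < 1 := by rw [hϖ, ← WithZero.exp_zero, WithZero.exp_lt_exp]; omega
    exact pow_lt_one₀ zero_le hϖ1 (by omega)
  refine ⟨dualLatt_sup_span_eq_of_glue hvσ hsymm hHrow hHcol hH11 hBW hlt hG1 hG2, fun c => ?_, ?_,
    Submodule.mem_sup_right (Submodule.mem_span_singleton_self x₀)⟩
  · -- tube coordinate `b`
    rw [single_mem_sup_span_iff_of_glue hvσ hsymm hHcol hH11 hBW hlt hG1 hG2 c, hx₀v, mul_inv_le_iff₀ (zero_lt_iff.2 hϖb0), one_mul]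
  · -- the W-part is exactly `B`
    refine le_antisymm ?_ (le_inf le_sup_left fun y hy => (hmemWk y).2 (hBW y hy))
    rintro w ⟨hw, hwW⟩
    obtain ⟨t, -, htB⟩ := mem_sup_span_singleton_iff.1 hw
    have h1 : (w - t • x₀) 1 = 0 := hBW _ htB
    rw [Pi.sub_apply, Pi.smul_apply, smul_eq_mul, (hmemWk w).1 hwW, zero_sub, neg_eq_zero, mul_eq_zero] at h1
    rcases h1 with ht | hx
    · rwa [ht, zero_smul, sub_zero] at htB
    · exact absurd hx hx₀10

end Literature.NumberTheory.Automorphic.UnitaryLatticeTree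

end
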